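import Mathlib
import HarnessLib
import Summits.Ventures.LatticeQCDFlow.Scoring.SU3TraceDeltoid

/-!
# The boundary of the deltoid consists of `SU(3)` traces: `t(θ) = 2e^{iθ} + e^{−2iθ}` is the trace of `diag(e^{iθ}, e^{iθ}, e^{−2iθ}) ∈ SU(3)` and has vanishing discriminant

HONEST FRAMING: exact (Metropolis-corrected) sampling algorithms for lattice gauge theory;
figures of merit are autocorrelation/cost numbers at stated couplings and volumes; no
continuum-physics claim.

Venture `LatticeQCDFlow` (cell pub-lqcd), sub-topic `Scoring`; FANOUT row 21 (`su3-base`: the 4D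
`SU(3)` baselines).  NEW WORK of the cell (placement rule), elementary, over row 21 GEN-8's
`Scoring/SU3TraceDeltoid` (`su3_trace_discriminant_eq_zero_iff`: for a diagonalisation the
discriminant expression `|t|⁴ − 8 Re t³ + 18|t|² − 27` vanishes iff two eigenvalues coincide) and
the Literature's `QuantumLattice/GaugeGroupsProofs` (`diagonal_mem_specialUnitaryGroup_iff`).  No
definition is introduced; nothing is cited as a fact; no number of ours.  Companion of
`Scoring/SU3TraceRangeSpokes` (the three spokes are traces): here the BOUNDARY curve.

The classical parametrisation of the deltoid (three-cusped hypocycloid) is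
`θ ↦ t(θ) = 2e^{iθ} + e^{−2iθ}`.  Each such point IS an `SU(3)` trace — of the torus element
`D(θ) = diag(e^{iθ}, e^{iθ}, e^{−2iθ})`, which has a REPEATED eigenvalue — and therefore (by
`su3_trace_discriminant_eq_zero_iff` applied to the trivial diagonalisation `D = 1·D·1⁻¹`) satisfies
`|t|⁴ − 8 Re t³ + 18|t|² − 27 = 0`: the boundary of the region of `SU3TraceDeltoid`.  The cusps
`θ = 0, 2π/3, 4π/3` are the centre (`t = 3ζ`), cf. `SU3TraceLowerBound` / `SU3TraceModulusCentre`.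

## What is proved

* `deltoidDiag_mem` — `diag(e^{iθ}, e^{iθ}, e^{−2iθ}) ∈ SU(3)`; `trace_deltoidDiag` — its trace is
  `2e^{iθ} + e^{−2iθ}`;
* **`mem_range_trace_deltoid_boundary`** — every `2e^{iθ} + e^{−2iθ}` is an `SU(3)` trace;
* **`deltoid_boundary_discriminant_eq_zero`** — `|t|⁴ − 8 Re t³ + 18|t|² − 27 = 0` at
  `t = 2e^{iθ} + e^{−2iθ}`, for every real `θ`;
* `deltoid_boundary_zero` (`θ = 0 ↦ t = 3`).

NOT CLAIMED: that these points exhaust the boundary / the zero set of the discriminant among traces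
(the converse direction), or surjectivity of the trace onto the closed region.
-/

namespace Summit.Ventures.LatticeQCDFlow.Scoring

open Matrix Complex
open Literature.MathematicalPhysics.QuantumLattice

section SpecialUnitaryThree

/-- The boundary witness `diag(e^{iθ}, e^{iθ}, e^{−2iθ})` lies in `SU(3)`. -/
theorem deltoidDiag_mem (θ : ℝ) :
    Matrix.diagonal (![Complex.exp ((θ : ℂ) * Complex.I), Complex.exp ((θ : ℂ) * Complex.I),
        Complex.exp (((-(2 * θ) : ℝ) : ℂ) * Complex.I)] : Fin 3 → ℂ) ∈
      Matrix.specialUnitaryGroup (Fin 3) ℂ := by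
  rw [diagonal_mem_specialUnitaryGroup_iff]
  refine ⟨fun i => ?_, ?_⟩
  · fin_cases i
    · exact Complex.norm_exp_ofReal_mul_I θ
    · exact Complex.norm_exp_ofReal_mul_I θ
    · exact Complex.norm_exp_ofReal_mul_I (-(2 * θ))
  · rw [Fin.prod_univ_three]
    simp only [Matrix.cons_val_zero, Matrix.cons_val_one, Matrix.cons_val]
    rw [← Complex.exp_add, ← Complex.exp_add]
    have h : (θ : ℂ) * Complex.I + (θ : ℂ) * Complex.I + ((-(2 * θ) : ℝ) : ℂ) * Complex.I = 0 := by
      push_cast; ring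
    rw [h, Complex.exp_zero]

/-- The trace of the boundary witness is the deltoid point `2e^{iθ} + e^{−2iθ}`. -/
theorem trace_deltoidDiag (θ : ℝ) :
    (Matrix.diagonal (![Complex.exp ((θ : ℂ) * Complex.I), Complex.exp ((θ : ℂ) * Complex.I),
        Complex.exp (((-(2 * θ) : ℝ) : ℂ) * Complex.I)] : Fin 3 → ℂ)).trace =
      2 * Complex.exp ((θ : ℂ) * Complex.I) + Complex.exp (((-(2 * θ) : ℝ) : ℂ) * Complex.I) := by
  rw [trace_diagonal, Fin.sum_univ_three]
  simp only [Matrix.cons_val_zero, Matrix.cons_val_one, Matrix.cons_val]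
  ring

/-- **Every point `2e^{iθ} + e^{−2iθ}` of the deltoid curve is an `SU(3)` trace.** -/
theorem mem_range_trace_deltoid_boundary (θ : ℝ) :
    ∃ U : Matrix.specialUnitaryGroup (Fin 3) ℂ,
      (U : Matrix (Fin 3) (Fin 3) ℂ).trace =
        2 * Complex.exp ((θ : ℂ) * Complex.I) + Complex.exp (((-(2 * θ) : ℝ) : ℂ) * Complex.I) :=
  ⟨⟨_, deltoidDiag_mem θ⟩, trace_deltoidDiag θ⟩

/-- **The deltoid curve is the zero set of the discriminant**: at `t = 2e^{iθ} + e^{−2iθ}`,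
`|t|⁴ − 8 Re t³ + 18|t|² − 27 = 0` (the witness has a repeated eigenvalue). -/
theorem deltoid_boundary_discriminant_eq_zero (θ : ℝ) :
    ‖2 * Complex.exp ((θ : ℂ) * Complex.I) + Complex.exp (((-(2 * θ) : ℝ) : ℂ) * Complex.I)‖ ^ 4
      - 8 * ((2 * Complex.exp ((θ : ℂ) * Complex.I) + Complex.exp (((-(2 * θ) : ℝ) : ℂ) * Complex.I)) ^ 3).re
      + 18 * ‖2 * Complex.exp ((θ : ℂ) * Complex.I) + Complex.exp (((-(2 * θ) : ℝ) : ℂ) * Complex.I)‖ ^ 2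
      - 27 = 0 := by
  set D : Matrix.specialUnitaryGroup (Fin 3) ℂ := ⟨_, deltoidDiag_mem θ⟩ with hDdef
  have hD : (D : Matrix (Fin 3) (Fin 3) ℂ) = Matrix.diagonal
      (![Complex.exp ((θ : ℂ) * Complex.I), Complex.exp ((θ : ℂ) * Complex.I),
        Complex.exp (((-(2 * θ) : ℝ) : ℂ) * Complex.I)] : Fin 3 → ℂ) := rfl
  have hU : D = 1 * D * 1⁻¹ := by group
  have h := (su3_trace_discriminant_eq_zero_iff (U := D) (u := 1) hD hU).mpr (Or.inl rfl)
  rw [← trace_deltoidDiag θ]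
  exact h

/-- The cusp at `θ = 0` is the identity's trace `3`. -/
theorem deltoid_boundary_zero :
    2 * Complex.exp (((0 : ℝ) : ℂ) * Complex.I) + Complex.exp (((-(2 * (0 : ℝ)) : ℝ) : ℂ) * Complex.I)
      = 3 := by
  simp
  norm_num

end SpecialUnitaryThree

end Summit.Ventures.LatticeQCDFlow.Scoring
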